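import Literature.NumberTheory.LFunctions.ConeWeylSums
import Literature.NumberTheory.Sieve.NumberFieldLargeSieve
import HarnessLib

/-!
# Balanced generators: multiplying by a totally positive unit to equalise the conjugates

Topic `Literature/NumberTheory/Sieve`, sub-namespace `Balanced`. Hinz 1988, §4 (4.14): "we fix a
totally positive generator `α₁` of `𝔭₁𝔞` such that `|α₁^{(k)}|^{e_k} ≍ Nα₁^{1/(r+1)}`" — every
nonzero `x ∈ K` can be multiplied by a totally positive unit `u` so that all conjugates of `ux` are
`≤ C_K |N(x)|^{1/d}` (and hence `≍ |N(x)|^{1/d}`). Proof: the logarithms of the totally positive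
units form a full lattice `L⁺` in the trace-zero hyperplane (the tree's
`HeckeCone.posUnitLattice`, an `IsZLattice`); translate the vector
`(e_w(log |x|_w − (1/d) log|N x|))_{w ≠ w₀}` into a (bounded) fundamental domain of `L⁺` by a
lattice vector `log u`, and control the remaining coordinate `w₀` through
`∑_w e_w log|ux|_w = log|N x|`. Everything is PROVED:

* `sum_mult_mul_log_eq` — `∑_w e_w log |x|_w = log |N(x)|` for `x ≠ 0`;
* `exists_posUnit_log_le` — **balanced associates**: `∃ C, ∀ x ≠ 0, ∃ u ∈ U⁺,
  ∀ w, log |ux|_w ≤ (1/d) log|N x| + C`;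
* `exists_posUnit_le_rpow` — the same exponentiated: `|ux|_w ≤ e^C |N x|^{1/d}`;
* `exists_balanced_totPos` (totally real `K`) — for totally positive `α ∈ 𝓞_K` a totally positive
  associate `uα` with `0 < σ_w(uα) ≤ e^C N(α)^{1/d}` for all real places `w`.

## References

* J. Hinz, Acta Arith. 51 (1988), §4 (4.13)–(4.14). [cite: Hinz1988, §4 (4.14)]
-/

noncomputable section

open NumberField NumberField.InfinitePlace NumberField.Units NumberField.Units.dirichletUnitTheorem
  Literature.NumberTheory.LFunctions Literature.NumberTheory.LFunctions.HeckeCone Finset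
  Literature.NumberTheory.Sieve.NumberFieldLS
open scoped Classical

namespace Literature.NumberTheory.Sieve.Balanced

variable (K : Type*) [Field K] [NumberField K]

local notation "d" => Module.finrank ℚ K

variable {K} in
/-- `∑_w e_w log |x|_w = log |N(x)|` for `x ≠ 0` (logarithm of the product formula at infinity).
[folklore] -/
theorem sum_mult_mul_log_eq {x : K} (hx : x ≠ 0) :
    ∑ w : InfinitePlace K, (mult w : ℝ) * Real.log (w x) = Real.log |((Algebra.norm ℚ x : ℚ) : ℝ)| := by
  have h := congr_arg Real.log (prod_eq_abs_norm x)
  rw [Real.log_prod] at h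
  · simp_rw [Real.log_pow] at h
    rw [h]
    push_cast
    rfl
  · intro w _
    exact pow_ne_zero _ ((map_ne_zero w).2 hx)

/-- **Balanced associates.** There is `C = C(K)` such that every nonzero `x ∈ K` has a totally
positive unit `u` with `log |ux|_w ≤ (1/d) log |N(x)| + C` for every infinite place `w`.
[cite: Hinz1988, §4 (4.14)] -/
theorem exists_posUnit_log_le : ∃ C : ℝ, 0 ≤ C ∧ ∀ x : K, x ≠ 0 → ∃ u : (𝓞 K)ˣ, u ∈ posUnits K ∧
    ∀ w : InfinitePlace K, Real.log (w (((u : 𝓞 K) : K) * x)) ≤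
      Real.log |((Algebra.norm ℚ x : ℚ) : ℝ)| / d + C := by
  -- the lattice `L⁺` and a bounded fundamental domain
  let bL := Module.Free.chooseBasis ℤ (posUnitLattice K)
  let b := bL.ofZLatticeBasis ℝ (posUnitLattice K)
  obtain ⟨R, hR⟩ := (ZSpan.fundamentalDomain_isBounded b).subset_closedBall 0
  have hR0 : 0 ≤ R := by
    have h0 : (0 : logSpace K) ∈ ZSpan.fundamentalDomain b := by
      rw [ZSpan.mem_fundamentalDomain]; intro i; simp
    have := hR h0
    rwa [Metric.mem_closedBall, dist_zero_right, norm_zero] at this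
  set n : ℕ := Fintype.card {w : InfinitePlace K // w ≠ w₀} with hn
  refine ⟨(n + 1) * R, by positivity, fun x hx => ?_⟩
  -- the vector to be translated
  set N : ℝ := Real.log |((Algebra.norm ℚ x : ℚ) : ℝ)| with hN
  set ℓ : ℝ := N / d with hℓ
  set v : logSpace K := fun w => (mult w.1 : ℝ) * (Real.log (w.1 x) - ℓ) with hv
  set y : logSpace K := ZSpan.fract b (-v) with hy
  have hyR : ‖y‖ ≤ R := by
    have := hR (ZSpan.fract_mem_fundamentalDomain b (-v))
    rwa [Metric.mem_closedBall, dist_zero_right] at this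
  have hmem : -v - y ∈ posUnitLattice K := by
    have h1 : -v - y = (ZSpan.floor b (-v) : logSpace K) := by
      rw [hy, ZSpan.fract_apply]; abel
    have h2 : (ZSpan.floor b (-v) : logSpace K) ∈ Submodule.span ℤ (Set.range b) := (ZSpan.floor b (-v)).2
    have h3 : Submodule.span ℤ (Set.range b) = posUnitLattice K := bL.ofZLatticeBasis_span ℝ (posUnitLattice K)
    rw [h1]
    exact (SetLike.ext_iff.1 h3 _).1 h2
  obtain ⟨u, hu, hlog⟩ := exists_of_mem_posUnitLattice hmem
  refine ⟨u, hu, fun w => ?_⟩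
  have hux : ∀ w : InfinitePlace K, w (((u : 𝓞 K) : K) * x) = w ((u : 𝓞 K) : K) * w x := fun w => map_mul w _ _
  have hu0 : ∀ w : InfinitePlace K, w ((u : 𝓞 K) : K) ≠ 0 := fun w =>
    (map_ne_zero w).2 (by exact_mod_cast u.ne_zero)
  have hx0 : ∀ w : InfinitePlace K, w x ≠ 0 := fun w => (map_ne_zero w).2 hx
  have hlogux : ∀ w : InfinitePlace K, Real.log (w (((u : 𝓞 K) : K) * x)) =
      Real.log (w ((u : 𝓞 K) : K)) + Real.log (w x) := fun w => by
    rw [hux, Real.log_mul (hu0 w) (hx0 w)]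
  -- the coordinates `w ≠ w₀`
  have hcoord : ∀ w' : {w : InfinitePlace K // w ≠ w₀},
      (mult w'.1 : ℝ) * (Real.log (w'.1 (((u : 𝓞 K) : K) * x)) - ℓ) = -y w' := by
    intro w'
    have h1 := congr_fun hlog w'
    rw [logEmbedding_component] at h1
    have h2 : (-v - y) w' = -((mult w'.1 : ℝ) * (Real.log (w'.1 x) - ℓ)) - y w' := by
      simp [hv]
    rw [h2] at h1
    rw [hlogux]
    linarith
  have hmult : ∀ w : InfinitePlace K, (1 : ℝ) ≤ mult w := fun w => by
    rw [mult]; split_ifs <;> norm_num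
  have hne : ∀ w' : {w : InfinitePlace K // w ≠ w₀},
      Real.log (w'.1 (((u : 𝓞 K) : K) * x)) - ℓ ≤ R := by
    intro w'
    have h1 := hcoord w'
    have h2 : |y w'| ≤ R := (norm_le_pi_norm y w').trans hyR
    have h3 : |(mult w'.1 : ℝ) * (Real.log (w'.1 (((u : 𝓞 K) : K) * x)) - ℓ)| ≤ R := by
      rw [h1, abs_neg]; exact h2
    rw [abs_mul, Nat.abs_cast] at h3
    have h4 : |Real.log (w'.1 (((u : 𝓞 K) : K) * x)) - ℓ| ≤ R := by
      have hm := hmult w'.1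
      have : |Real.log (w'.1 (((u : 𝓞 K) : K) * x)) - ℓ| ≤
          (mult w'.1 : ℝ) * |Real.log (w'.1 (((u : 𝓞 K) : K) * x)) - ℓ| :=
        le_mul_of_one_le_left (abs_nonneg _) hm
      exact this.trans h3
    exact (le_abs_self _).trans h4
  -- the coordinate `w₀` through the product formula
  have hsum : ∑ w : InfinitePlace K, (mult w : ℝ) * (Real.log (w (((u : 𝓞 K) : K) * x)) - ℓ) = 0 := by
    have h1 : ∑ w : InfinitePlace K, (mult w : ℝ) * Real.log (w (((u : 𝓞 K) : K) * x)) = N := by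
      simp_rw [hlogux, mul_add, Finset.sum_add_distrib]
      rw [sum_mult_mul_log u, zero_add, hN, sum_mult_mul_log_eq hx]
    have h2 : ∑ w : InfinitePlace K, (mult w : ℝ) * ℓ = N := by
      rw [← Finset.sum_mul, hℓ]
      have : ∑ w : InfinitePlace K, (mult w : ℝ) = d := by exact_mod_cast sum_mult_eq (K := K)
      rw [this, mul_div_cancel₀]
      exact_mod_cast Module.finrank_pos.ne'
    simp_rw [mul_sub, Finset.sum_sub_distrib, h1, h2, sub_self]
  have hw₀ : (mult (w₀ : InfinitePlace K) : ℝ) * (Real.log (w₀ (((u : 𝓞 K) : K) * x)) - ℓ) =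
      ∑ w' : {w : InfinitePlace K // w ≠ w₀}, y w' := by
    rw [Fintype.sum_eq_add_sum_subtype_ne _ w₀] at hsum
    simp_rw [hcoord] at hsum
    rw [Finset.sum_neg_distrib] at hsum
    linarith
  have hw₀le : Real.log (w₀ (((u : 𝓞 K) : K) * x)) - ℓ ≤ n * R := by
    have h1 : |∑ w' : {w : InfinitePlace K // w ≠ w₀}, y w'| ≤ n * R := by
      refine (Finset.abs_sum_le_sum_abs _ _).trans ?_
      calc ∑ w' : {w : InfinitePlace K // w ≠ w₀}, |y w'| ≤ ∑ _w' : {w : InfinitePlace K // w ≠ w₀}, R :=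
            Finset.sum_le_sum fun w' _ => (norm_le_pi_norm y w').trans hyR
        _ = n * R := by rw [Finset.sum_const, Finset.card_univ, nsmul_eq_mul]
    rw [← hw₀, abs_mul, Nat.abs_cast] at h1
    have hm := hmult w₀
    have h2 : |Real.log (w₀ (((u : 𝓞 K) : K) * x)) - ℓ| ≤ n * R :=
      (le_mul_of_one_le_left (abs_nonneg _) hm).trans h1
    exact (le_abs_self _).trans h2
  -- conclusion
  by_cases hw : w = w₀
  · subst hw
    have : (n : ℝ) * R ≤ (n + 1) * R := by nlinarith
    linarith
  · have := hne ⟨w, hw⟩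
    have : R ≤ (n + 1) * R := by nlinarith
    simp only at *
    linarith

/-- **Balanced associates, exponentiated**: `|ux|_w ≤ e^C |N x|^{1/d}`. [cite: Hinz1988, §4 (4.14)] -/
theorem exists_posUnit_le_rpow : ∃ C : ℝ, 1 ≤ C ∧ ∀ x : K, x ≠ 0 → ∃ u : (𝓞 K)ˣ, u ∈ posUnits K ∧
    ∀ w : InfinitePlace K, w (((u : 𝓞 K) : K) * x) ≤ C * |((Algebra.norm ℚ x : ℚ) : ℝ)| ^ (1 / (d : ℝ)) := by
  obtain ⟨C, hC0, h⟩ := exists_posUnit_log_le K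
  refine ⟨Real.exp C, Real.one_le_exp hC0, fun x hx => ?_⟩
  obtain ⟨u, hu, hle⟩ := h x hx
  refine ⟨u, hu, fun w => ?_⟩
  have hpos : 0 < w (((u : 𝓞 K) : K) * x) :=
    pos_iff.2 (mul_ne_zero (by exact_mod_cast u.ne_zero) hx)
  have hN : 0 < |((Algebra.norm ℚ x : ℚ) : ℝ)| := by
    rw [abs_pos]; exact_mod_cast Algebra.norm_ne_zero_iff.2 hx
  rw [← Real.log_le_log_iff hpos (by positivity), Real.log_mul (Real.exp_pos C).ne' (by positivity),
    Real.log_exp, Real.log_rpow hN]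
  have := hle w
  rw [one_div, inv_mul_eq_div]
  linarith

variable [IsTotallyReal K]

/-- A totally real field has a real place. [folklore] -/
instance nonempty_realPlaces : Nonempty {w : InfinitePlace K // w.IsReal} :=
  let ⟨w⟩ := (inferInstance : Nonempty (InfinitePlace K)); ⟨⟨w, IsTotallyReal.isReal w⟩⟩

/-- **Balanced totally positive associates** (totally real `K`): a totally positive `α ∈ 𝓞_K` has
a totally positive associate `uα` (`u` a totally positive unit) all of whose conjugates satisfy
`0 < σ_w(uα) ≤ C N(α)^{1/d}`. [cite: Hinz1988, §4 (4.14)] -/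
theorem exists_balanced_totPos : ∃ C : ℝ, 1 ≤ C ∧ ∀ α : 𝓞 K, NumberField.IsTotPos K (α : K) →
    ∃ u : (𝓞 K)ˣ, u ∈ posUnits K ∧ NumberField.IsTotPos K (((u : 𝓞 K) * α : 𝓞 K) : K) ∧
      ∀ w : {w : InfinitePlace K // w.IsReal},
        remb K (((u : 𝓞 K) * α : 𝓞 K) : K) w ≤ C * (Ideal.absNorm (Ideal.span {α}) : ℝ) ^ (1 / (d : ℝ)) := by
  obtain ⟨C, hC1, h⟩ := exists_posUnit_le_rpow K
  refine ⟨C, hC1, fun α hα => ?_⟩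
  have hα0 : (α : K) ≠ 0 := by
    intro h0
    obtain ⟨w⟩ := (inferInstance : Nonempty {w : InfinitePlace K // w.IsReal})
    have := hα w
    rw [h0, map_zero] at this
    exact lt_irrefl _ this
  obtain ⟨u, hu, hle⟩ := h (α : K) hα0
  have hpos : NumberField.IsTotPos K (((u : 𝓞 K) * α : 𝓞 K) : K) := by
    intro w
    have h1 : ((((u : 𝓞 K) * α : 𝓞 K) : K)) = ((u : 𝓞 K) : K) * (α : K) := by push_cast; rfl
    rw [h1, map_mul, Prod.fst_mul, Pi.mul_apply]
    refine mul_pos ?_ (hα w)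
    have := (mem_posUnits_iff.1 hu) w
    exact this
  refine ⟨u, hu, hpos, fun w => ?_⟩
  have h1 : ((((u : 𝓞 K) * α : 𝓞 K) : K)) = ((u : 𝓞 K) : K) * (α : K) := by push_cast; rfl
  have h2 : remb K (((u : 𝓞 K) * α : 𝓞 K) : K) w = w.1 ((((u : 𝓞 K) * α : 𝓞 K) : K)) := by
    rw [← abs_remb, abs_of_pos]
    exact hpos w
  have h3 : (Ideal.absNorm (Ideal.span {α}) : ℝ) = |(Algebra.norm ℚ (α : K) : ℝ)| := by
    rw [Ideal.absNorm_span_singleton, ← Algebra.coe_norm_int α, Rat.cast_intCast, Nat.cast_natAbs,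
      Int.cast_abs]
  rw [h2, h1, h3]
  exact hle w.1

end Literature.NumberTheory.Sieve.Balanced
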